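/-
Copyright (c) 2026 the pub-hodgecm-mathlib formalisation cell (harness21).  Prover seat hodgecm-mathlib-A-p14 (g32), P6 «MOD programme»,
P6a desk F0P6a-plan (g1) ORGAN DEALS #1 (O-α) «HECKE–SERRE CONSTRUCTOR», FILE α2a; 2026-09-01.
-/
import Literature.AlgebraicGeometry.AbelianSchemes.SerreTensorIdealTranslationQuasiInverse
import HarnessLib

/-!
# The COVER `c = A ⊗ (𝔞 ↪ 𝒪) : A ⊗_𝒪 𝔞 ⟶ A` of the Serre tensor by an INTEGRAL ideal: `c ≫ ψ_a = ι(a)` for `a ∈ 𝔞`, `Ker c ⊆ (A ⊗ 𝔞)[𝔞]`,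
# and `c` is finite, flat and surjective (B. Conrad, *Gross–Zagier revisited* §7; [RapoportSmithlingZhang2020Diagonal] (4.23))

Topic `AlgebraicGeometry/AbelianSchemes`, namespace `Literature.AlgebraicGeometry.AbelianSchemes.AbelianSchemeOver`.  THEOREMS ONLY (no definition, no named
fact, no `instance`, no notation, no `sorry`; ANY base scheme `S`).  Cell `hodgecm-mathlib` (D-0151), F0/P6 «MOD», P6a desk F0P6a-plan (g1) ORGAN DEALS #1
**(O-α) «HECKE–SERRE CONSTRUCTOR», FILE α2a** = the normalisation-free half of the SERRE STEP `A′ := (A∕K) ⊗_{𝒪_F} 𝔭_w` (LEAD M-17c D-2: the Hecke–Serre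
constructor form `tuple(quotΩ y L) ≅ (tuple(y) ∕ (H_L ⊕ H_L^⊥)) ⊗_{𝒪_F} 𝔭_w`), stated for a GENERIC abelian scheme `A` with `𝒪`-action (for (O-α): `A := A∕K` with
the descended action ★ `RingAction.quotient`, FILE α1); `--supports stmt-HodgeConjecture-24832`, COUNT-NEUTRAL.  HONEST LABEL: HC_CM is proved only modulo the 2
remaining named inputs (hLiu418 24832, h413 24833) until rung 0 closes; this file discharges none of them.

## Mathematics

`A∕S` an abelian scheme with commutative group law and a ring action `ι : 𝒪 → End_S(A)` (★ `RingAction`); `𝔞` an (integral) ideal of `𝒪` which is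
finitely generated projective as a module, PRESENTED as `𝔟 = E′·𝒪ᵐ` (`E′² = E′`) together with its INCLUSION FUNCTIONAL `Q ∈ M_{1×m}(𝒪)`, `Q E′ = Q`
(the module map `𝔟 → 𝒪` that is the inclusion `𝔞 ⊆ 𝒪`).  The COVER is the Serre map of `Q`,
  `c := ψ′_Q = (A ⊗ Q) ≫ (A ⊗_𝒪 𝒪 ≅ A) : A ⊗_𝒪 𝔞 ⟶ A`   (★ `serreTranslateInv`),
a homomorphism, `𝒪`-equivariant (★ `i_comp_serreTranslateInv`).  An element `a ∈ 𝔞` is a column `P_a ∈ 𝔟` (`E′P_a = P_a`) with `Q P_a = a`, and then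
`P_a Q = a·E′` on `𝔟` (both send `v ↦ Q(v)·a`; (§1) this is the matrix identity consumers supply, or derive from `Q P_a = a` when `Q` is injective on `𝔟`);
hence (§1) **`c ≫ ψ_{P_a} = ι_{A⊗𝔞}(a)`** (★ `serrePresentationHom_comp_of` + ★ `serrePresentationHom_smul_self`) and dually ★ `ψ_{P_a} ≫ c = ι_A(a)`.
Consequently (§2) **`Ker c ⊆ (A ⊗ 𝔞)[𝔞]`** on `T`-valued points: `t ≫ c = 1 ⇒ t ≫ ι(a) = t ≫ c ≫ ψ_{P_a} = 1` for every `a ∈ 𝔞` so presented (the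
reverse inclusion uses invertibility of `𝔞` and is not in this file).  (§3) If some `a = N ∈ 𝔞 ∩ ℕ`, `N ≠ 0` (e.g. `p ∈ 𝔭_w`), then `P_N` is a
quasi-inverse of `Q` (`Q P_N = N`, `P_N Q = N·E′`) and **`c` is FINITE, FLAT and SURJECTIVE** (★ `SerreTensorIsogeny` through ★ `serreTensorOneIso`), with
★ `ψ_{P_N} ≫ c = ι(N) = [N]`, `c ≫ ψ_{P_N} = [N]` (★ `serreTranslate_comp_serreTranslateInv`, `serreTranslateInv_comp_serreTranslate`).  [Conrad2004GrossZagier] §7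
(Thm. 7.5: `M ⊗_𝒪 A → N ⊗_𝒪 A` for `M ↪ N` of finite index is an isogeny); [RapoportSmithlingZhang2020Diagonal] §4 (4.23) p. 21; [MilneCM2006] §7.

## Contents

* §1 `serreTranslateInv_eq` (`c = (A ⊗ Q) ≫ (A ⊗ 𝒪 ≅ A)`, `rfl` bookkeeping), **`serreTranslateInv_comp_serreTranslate_of_mul_eq_smul`**
  (`c ≫ ψ_{P_a} = ι_{A⊗𝔞}(a)` from `E′P_a = P_a`, `P_a Q = a • E′`).
* §2 **`comp_serreAction_i_eq_one_of_comp_serreTranslateInv_eq_one`** (one `a`), **`forall_comp_serreAction_i_eq_one_of_comp_serreTranslateInv_eq_one`**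
  (`Ker c ⊆ (A ⊗ 𝔞)[𝔞]` for any set of `a`'s so presented).
* §3 **`isFinite_serreTranslateInv_left`**, **`flat_serreTranslateInv_left`**, **`surjective_serreTranslateInv_left`** (quasi-inverse `P`, `N ≠ 0`).

## References
* [Conrad2004GrossZagier] B. Conrad, *Gross–Zagier revisited*, MSRI Publ. 49 (2004), §7 «The Serre tensor construction», Thm. 7.5.
* [RapoportSmithlingZhang2020Diagonal] M. Rapoport, B. Smithling, W. Zhang (2020), §4, (4.23) (p. 21).
* [MilneCM2006] J. S. Milne, *Complex Multiplication* (2006), §7 «𝔞-multiplications» (Def. 7.19–Rem. 7.23, pp. 58–59).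
* Tree: ★ `SerreTensorIdealTranslationQuasiInverse`, ★ `SerreTensorIdealTranslationKernel`, ★ `SerreTensorIsogeny`, ★ `SerreTensorQuasiInverse`, ★ `SerreTensorModuleMap`.
-/

set_option autoImplicit false

noncomputable section

universe u

open CategoryTheory CategoryTheory.Limits AlgebraicGeometry MonoidalCategory CartesianMonoidalCategory
open scoped MonObj

namespace Literature.AlgebraicGeometry.AbelianSchemes

namespace AbelianSchemeOver

variable {S : Scheme.{u}} {A : AbelianSchemeOver S} {O : Type*} [CommRing O] (act : A.RingAction O) [IsCommMonObj A.X]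
  {m : ℕ} (E' : Matrix (Fin m) (Fin m) O) (hE' : E' * E' = E') (Q : Matrix (Fin 1) (Fin m) O)

/-! ## §1 `c ≫ ψ_{P_a} = ι(a)` -/

section Cover

/-- Bookkeeping: the cover `c = ψ′_Q` IS `(A ⊗ Q) ≫ (A ⊗_𝒪 𝒪 ≅ A)` (`rfl`). [cite: Conrad2004GrossZagier, §7 (Thm. 7.5)] -/
theorem serreTranslateInv_eq :
    serreTranslateInv act E' hE' Q =
      serrePresentationHom act E' hE' (1 : Matrix (Fin 1) (Fin 1) O) one_mul_one_fin_one Q ≫ (serreTensorOneIso act).hom := rfl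

/-- **`c ≫ ψ_{P_a} = ι_{A ⊗ 𝔞}(a)`**: the cover followed by the ideal translation of an element `a ∈ 𝔞` (column `P_a` with `E′P_a = P_a` and `P_a Q = a • E′`)
is the `a`-multiplication of `A ⊗_𝒪 𝔞`. [cite: Conrad2004GrossZagier, §7 (Thm. 7.5)] [cite: RapoportSmithlingZhang2020Diagonal, §4 (4.23) (p. 21)] -/
theorem serreTranslateInv_comp_serreTranslate_of_mul_eq_smul (hQ : Q * E' = Q) {a : O} (Pa : Matrix (Fin m) (Fin 1) O)
    (hPa : E' * Pa = Pa) (hPaQ : Pa * Q = a • E') :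
    serreTranslateInv act E' hE' Q ≫ serreTranslate act E' hE' Pa = (serreAction act E' hE').i a := by
  rw [serreTranslateInv_eq, serreTranslate, Category.assoc, Iso.hom_inv_id_assoc,
    serrePresentationHom_comp_of act E' hE' (1 : Matrix (Fin 1) (Fin 1) O) one_mul_one_fin_one E' hE' Q
      (by rw [Matrix.one_mul, hQ]) Pa (by rw [Matrix.mul_one, hPa]),
    hPaQ, serrePresentationHom_smul_self]

end Cover

/-! ## §2 `Ker c ⊆ (A ⊗ 𝔞)[𝔞]` on points -/

section Kernel

/-- **One element**: if `t ≫ c = 1` then `t ≫ ι_{A⊗𝔞}(a) = 1` for every `a ∈ 𝔞` presented by a column `P_a` (`E′P_a = P_a`, `P_a Q = a • E′`).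
[cite: Conrad2004GrossZagier, §7 (Thm. 7.5)] -/
theorem comp_serreAction_i_eq_one_of_comp_serreTranslateInv_eq_one (hQ : Q * E' = Q) {a : O} (Pa : Matrix (Fin m) (Fin 1) O)
    (hPa : E' * Pa = Pa) (hPaQ : Pa * Q = a • E') {T : Over S} (t : T ⟶ (serreTensor act E' hE').X)
    (ht : t ≫ serreTranslateInv act E' hE' Q = 1) : t ≫ (serreAction act E' hE').i a = 1 := by
  haveI := isMonHom_serreTranslate act E' hE' Pa
  rw [← serreTranslateInv_comp_serreTranslate_of_mul_eq_smul act E' hE' Q hQ Pa hPa hPaQ, ← Category.assoc, ht, MonObj.one_comp]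

/-- **`Ker c ⊆ (A ⊗ 𝔞)[𝔞]` on `T`-valued points**: if every `a` in a set `𝔞` is presented by some column `P_a ∈ 𝔟` with `P_a Q = a • E′`, then a point killed by
the cover `c` is killed by `ι(a)` for all `a ∈ 𝔞`. [cite: Conrad2004GrossZagier, §7 (Thm. 7.5)] [cite: MilneCM2006, §7] -/
theorem forall_comp_serreAction_i_eq_one_of_comp_serreTranslateInv_eq_one (hQ : Q * E' = Q) (𝔞 : Set O)
    (h𝔞 : ∀ a ∈ 𝔞, ∃ Pa : Matrix (Fin m) (Fin 1) O, E' * Pa = Pa ∧ Pa * Q = a • E') {T : Over S} (t : T ⟶ (serreTensor act E' hE').X)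
    (ht : t ≫ serreTranslateInv act E' hE' Q = 1) : ∀ a ∈ 𝔞, t ≫ (serreAction act E' hE').i a = 1 := by
  intro a ha
  obtain ⟨Pa, hPa, hPaQ⟩ := h𝔞 a ha
  exact comp_serreAction_i_eq_one_of_comp_serreTranslateInv_eq_one act E' hE' Q hQ Pa hPa hPaQ t ht

end Kernel

/-! ## §3 `c` is finite, flat and surjective (quasi-inverse `P_N`, `N ≠ 0`) -/

section Isogeny

variable (P : Matrix (Fin m) (Fin 1) O) {N : ℕ}

/-- `c₀ := A ⊗ Q : A ⊗ 𝔞 ⟶ A ⊗_𝒪 𝒪` is FINITE when `Q` has a quasi-inverse column `P` up to `N ≠ 0` (`E′P = P`, `QE′ = Q`, `QP = N`, `PQ = N·E′`).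
[cite: Conrad2004GrossZagier, §7 (Thm. 7.5)] -/
theorem isFinite_serrePresentationHom_one_left (hN : N ≠ 0) (hP : E' * P = P) (hQ : Q * E' = Q)
    (hQP : Q * P = Matrix.scalar (Fin 1) (N : O)) (hPQ : P * Q = Matrix.scalar (Fin m) (N : O) * E') :
    IsFinite (serrePresentationHom act E' hE' (1 : Matrix (Fin 1) (Fin 1) O) one_mul_one_fin_one Q).left :=
  isFinite_serrePresentationHom_left act E' hE' (1 : Matrix (Fin 1) (Fin 1) O) one_mul_one_fin_one Q P hN
    (by rw [Matrix.one_mul, hQ]) (by rw [Matrix.mul_one, hP]) hPQ (by rw [hQP, Matrix.mul_one])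

/-- `c₀ := A ⊗ Q` is FLAT (same hypotheses). [cite: Conrad2004GrossZagier, §7 (Thm. 7.5)] -/
theorem flat_serrePresentationHom_one_left (hN : N ≠ 0) (hP : E' * P = P) (hQ : Q * E' = Q)
    (hQP : Q * P = Matrix.scalar (Fin 1) (N : O)) (hPQ : P * Q = Matrix.scalar (Fin m) (N : O) * E') :
    Flat (serrePresentationHom act E' hE' (1 : Matrix (Fin 1) (Fin 1) O) one_mul_one_fin_one Q).left :=
  flat_serrePresentationHom_left act E' hE' (1 : Matrix (Fin 1) (Fin 1) O) one_mul_one_fin_one Q P hN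
    (by rw [Matrix.one_mul, hQ]) (by rw [Matrix.mul_one, hP]) hPQ (by rw [hQP, Matrix.mul_one])

/-- `c₀ := A ⊗ Q` is SURJECTIVE (same hypotheses). [cite: Conrad2004GrossZagier, §7 (Thm. 7.5)] -/
theorem surjective_serrePresentationHom_one_left (hN : N ≠ 0) (hP : E' * P = P) (hQ : Q * E' = Q)
    (hQP : Q * P = Matrix.scalar (Fin 1) (N : O)) (hPQ : P * Q = Matrix.scalar (Fin m) (N : O) * E') :
    Surjective (serrePresentationHom act E' hE' (1 : Matrix (Fin 1) (Fin 1) O) one_mul_one_fin_one Q).left :=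
  surjective_serrePresentationHom_left act E' hE' (1 : Matrix (Fin 1) (Fin 1) O) one_mul_one_fin_one Q P hN
    (by rw [Matrix.one_mul, hQ]) (by rw [Matrix.mul_one, hP]) hPQ (by rw [hQP, Matrix.mul_one])

/-- **The cover `c : A ⊗_𝒪 𝔞 ⟶ A` is FINITE** (quasi-inverse `P`, `N ≠ 0`). [cite: Conrad2004GrossZagier, §7 (Thm. 7.5)] -/
theorem isFinite_serreTranslateInv_left (hN : N ≠ 0) (hP : E' * P = P) (hQ : Q * E' = Q)
    (hQP : Q * P = Matrix.scalar (Fin 1) (N : O)) (hPQ : P * Q = Matrix.scalar (Fin m) (N : O) * E') :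
    IsFinite (serreTranslateInv act E' hE' Q).left := by
  haveI := isFinite_serrePresentationHom_one_left act E' hE' Q P hN hP hQ hQP hPQ
  rw [serreTranslateInv_eq, Over.comp_left]
  infer_instance

/-- **The cover `c` is FLAT.** [cite: Conrad2004GrossZagier, §7 (Thm. 7.5)] -/
theorem flat_serreTranslateInv_left (hN : N ≠ 0) (hP : E' * P = P) (hQ : Q * E' = Q)
    (hQP : Q * P = Matrix.scalar (Fin 1) (N : O)) (hPQ : P * Q = Matrix.scalar (Fin m) (N : O) * E') :
    Flat (serreTranslateInv act E' hE' Q).left := by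
  haveI := flat_serrePresentationHom_one_left act E' hE' Q P hN hP hQ hQP hPQ
  rw [serreTranslateInv_eq, Over.comp_left]
  infer_instance

/-- **The cover `c` is SURJECTIVE.** [cite: Conrad2004GrossZagier, §7 (Thm. 7.5)] -/
theorem surjective_serreTranslateInv_left (hN : N ≠ 0) (hP : E' * P = P) (hQ : Q * E' = Q)
    (hQP : Q * P = Matrix.scalar (Fin 1) (N : O)) (hPQ : P * Q = Matrix.scalar (Fin m) (N : O) * E') :
    Surjective (serreTranslateInv act E' hE' Q).left := by
  haveI := surjective_serrePresentationHom_one_left act E' hE' Q P hN hP hQ hQP hPQ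
  rw [serreTranslateInv_eq, Over.comp_left]
  infer_instance

end Isogeny

end AbelianSchemeOver

end Literature.AlgebraicGeometry.AbelianSchemes
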